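import Mathlib.Analysis.Calculus.ContDiff.Bounds
import Mathlib.Analysis.Calculus.IteratedDeriv.Lemmas
import Mathlib.Topology.Algebra.Module.FiniteDimension
import Mathlib.Data.Fin.Tuple.Sort
import Literature.Analysis.Calculus.IteratedFDerivBasisBounds
import Literature.Analysis.Calculus.IteratedFDerivSymmetric
import HarnessLib

/-!
# Jet entries are nested directional derivatives; bounds on `iteratedFDeriv` from bounds on nested partials (single function, graded)
# (Coleman, *Calculus on Normed Vector Spaces* §4.5; Hörmander ALPDO I §1.1)

Topic `Analysis/Calculus`; namespace `Literature.Analysis.Calculus`.  THEOREMS ONLY (no `def`, no instance, no axiom, no `sorry`).  Generic multivariable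
calculus — the SINGLE-FUNCTION, FINITE-ORDER companion of ★ `IteratedFDerivBasisBounds` (p850902, whose §2 is a FAMILY principle at ALL orders): written for
the (I₁) «bounded jets on `K ∩ InRegG`» clause of Bouaziz's orbital-family letter L1 (cell `pub/hodgecm-mathlib`, crux H413, line LH3, brick (B2b) of the
(I₁-CENSUS) of LH7-p04 (g4); count-neutral), where the analytic engines bound MIXED PARTIALS `∂_ψ^a ∂_y^β` of ONE function on a punctured neighbourhood and the
letter asks for `‖iteratedFDeriv ℝ n f x‖`.
* §1 **the dictionary** (Coleman §4.5 `∂^k f/∂x_{i₁}⋯∂x_{i_k}(a) = f^{(k)}(a)(e_{i₁}, …, e_{i_k})`, differentiating FIRST in `x_{i_k}`; Mathlib's `iteratedFDeriv` has its first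
  slot outermost): for `f ∈ Cⁿ(U)`, `U` open, `x ∈ U` and ANY vectors `m : Fin n → V`,
  `iteratedFDeriv_succ_apply_eq_iteratedFDeriv_fderiv_apply` (one peeling step, innermost derivative = LAST slot),
  **`iteratedFDeriv_apply_eq_foldr_fderiv`** `D^n f(x)(m) = (D_{m 0} (D_{m 1} ⋯ (D_{m (n-1)} f)))(x)` (core `Fin.foldr`, slot `0` outermost),
  `iteratedFDeriv_apply_const_eq_iterate_fderiv` (pure word `D^n f(x)(v,…,v) = (D_v^[n] f)(x)`, the idiom of ★ p850902 §3, which bridges it to `iteratedDeriv` of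
  the line restriction), `iteratedFDeriv_apply_append_eq_foldr_foldr` (two blocks `Fin.append v w`: `= (D_v-word (D_w-word f))(x)`),
  `iteratedFDeriv_apply_append_const_eq_iterate_foldr` (`D^{a+k} f(x)(v^a, w) = (D_v^[a] (D_w-word f))(x)` — the `∂_ψ^a ∂_y^β` shape).
* §2 **graded bounds**: `exists_forall_norm_iteratedFDeriv_le_of_apply_basis` (jet entries on basis tuples bounded on `A` ⇒ `‖D^n f‖` bounded on `A`; no smoothness —
  ★ p850902 §1), **`exists_forall_norm_iteratedFDeriv_le_of_foldr_fderiv_basis`** (= (B2b): nested partials of order `n` along all basis words bounded on `A ⊆ U`,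
  `f ∈ Cⁿ(U)` ⇒ `‖D^n f‖` bounded on `A`), `exists_forall_norm_iteratedFDeriv_le_of_foldr_fderiv_basis_monotone` (SORTED words suffice — Schwarz, ★
  `iteratedFDeriv_comp_perm_of_le` + Mathlib `Tuple.sort`), `bddAbove_norm_iteratedFDeriv_image_of_foldr_fderiv_basis` (all orders `k ≤ n`, `BddAbove` image form).
HONEST LABEL: generic calculus; HC_CM is proved only modulo the 7 printed citations (2 remaining: hLiu418 = stmt-HodgeConjecture-24832, h413 = stmt-HodgeConjecture-24833)
until rung 0 closes.

## References
* [Coleman2012] R. Coleman, *Calculus on Normed Vector Spaces*, Universitext (2012), §4.5 «Higher differentials and higher derivatives».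
* [HormanderALPDO1] L. Hörmander, *The Analysis of Linear Partial Differential Operators I*, 2nd ed. (1990), §1.1 pp. 7–12.

## Mathlib ∕ tree search
Mathlib: `iteratedFDerivWithin_succ_apply_right`, `iteratedFDerivWithin_clm_apply_const_apply`, `iteratedFDerivWithin_of_isOpen`, `Tuple.sort`∕`Tuple.monotone_sort`,
core `Fin.foldr_succ_last`∕`Fin.foldr_add`; tree ★ `IteratedFDerivBasisBounds` (family form, all orders), ★ `IteratedFDerivSymmetric` (Schwarz at all orders), ★
`MixedPartialDerivWithin` (`iteratedFDerivWithin_append_apply`, within product sets) — none states the single-function graded bound or exports the `Fin.foldr` dictionary.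
-/

set_option autoImplicit false

noncomputable section

open Set Filter Topology Function
open scoped ContDiff

namespace Literature.Analysis.Calculus

/-! ## §1 Jet entries are nested directional derivatives (open set, finite order) -/

section Words

variable {V : Type*} [NormedAddCommGroup V] [NormedSpace ℝ V] {F : Type*} [NormedAddCommGroup F] [NormedSpace ℝ F]

/-- **One peeling step** (innermost derivative = LAST slot): for `f ∈ C^{n+1}(U)`, `U` open, `x ∈ U`,
`D^{n+1} f(x)(m) = D^n (y ↦ Df(y)·m(last)) (x) (init m)`.  (Mathlib `iteratedFDerivWithin_succ_apply_right` + `iteratedFDerivWithin_clm_apply_const_apply` on the open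
`U`.) [cite: Coleman2012, §4.5] -/
theorem iteratedFDeriv_succ_apply_eq_iteratedFDeriv_fderiv_apply {U : Set V} (hU : IsOpen U) {f : V → F} {n : ℕ}
    (hf : ContDiffOn ℝ (n + 1) f U) {x : V} (hx : x ∈ U) (m : Fin (n + 1) → V) :
    iteratedFDeriv ℝ (n + 1) f x m = iteratedFDeriv ℝ n (fun y => fderiv ℝ f y (m (Fin.last n))) x (Fin.init m) := by
  have hc : ContDiffOn ℝ n (fun y => fderivWithin ℝ f U y) U := hf.fderivWithin hU.uniqueDiffOn le_rfl
  have happly := iteratedFDerivWithin_clm_apply_const_apply (𝕜 := ℝ) hU.uniqueDiffOn hc (i := n) le_rfl hx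
    (u := m (Fin.last n)) (m := Fin.init m)
  have heq : EqOn (fun y => fderivWithin ℝ f U y (m (Fin.last n))) (fun y => fderiv ℝ f y (m (Fin.last n))) U :=
    fun y hy => by simp only [fderivWithin_of_isOpen hU hy]
  rw [← iteratedFDerivWithin_of_isOpen (n + 1) hU hx, iteratedFDerivWithin_succ_apply_right hU.uniqueDiffOn hx, ← happly,
    ← iteratedFDerivWithin_of_isOpen n hU hx, iteratedFDerivWithin_congr heq hx]

/-- `D_v f = y ↦ Df(y)·v` is `Cⁿ` on the open `U` when `f ∈ C^{n+1}(U)` (finite-order twin of ★ `contDiffOn_fderiv_apply_const_of_isOpen` of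
`LaplacianCommutatorCarreDuChamp`, which is the `C^∞` statement; Mathlib `ContDiffOn.fderiv_of_isOpen`). [cite: Coleman2012, §4.5] -/
theorem contDiffOn_fderiv_apply_const_of_isOpen_succ {U : Set V} (hU : IsOpen U) {f : V → F} {n : ℕ} (hf : ContDiffOn ℝ (n + 1) f U) (v : V) :
    ContDiffOn ℝ n (fun y => fderiv ℝ f y v) U :=
  (hf.fderiv_of_isOpen hU le_rfl).clm_apply contDiffOn_const

/-- **JET ENTRIES ARE NESTED DIRECTIONAL DERIVATIVES**: for `f ∈ Cⁿ(U)`, `U` open, `x ∈ U` and any vectors `m : Fin n → V`,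
`D^n f(x)(m 0, …, m (n-1)) = (D_{m 0} (D_{m 1} ⋯ (D_{m (n-1)} f)))(x)` — core `Fin.foldr` (slot `0` is the OUTERMOST derivative, the last slot the innermost; Coleman's
`∂^k f/∂x_{i₁}⋯∂x_{i_k} = f^{(k)}(e_{i₁},…,e_{i_k})`). [cite: Coleman2012, §4.5] -/
theorem iteratedFDeriv_apply_eq_foldr_fderiv {U : Set V} (hU : IsOpen U) (n : ℕ) :
    ∀ {f : V → F}, ContDiffOn ℝ n f U → ∀ {x : V}, x ∈ U → ∀ m : Fin n → V,
      iteratedFDeriv ℝ n f x m = Fin.foldr n (fun k (g : V → F) => fun y => fderiv ℝ g y (m k)) f x := by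
  induction n with
  | zero => intro f _ x _ m; simp
  | succ n ih =>
    intro f hf x hx m
    have hf' : ContDiffOn ℝ (n + 1) f U := by exact_mod_cast hf
    rw [iteratedFDeriv_succ_apply_eq_iteratedFDeriv_fderiv_apply hU hf' hx m,
      ih (contDiffOn_fderiv_apply_const_of_isOpen_succ hU hf' (m (Fin.last n))) hx (Fin.init m), Fin.foldr_succ_last]
    rfl

/-- `Fin.foldr` of a constant step is the iterate (plumbing). [folklore] -/
private theorem foldr_const_eq_iterate {α : Type*} (h : α → α) (a : α) : ∀ n : ℕ, Fin.foldr n (fun _ => h) a = h^[n] a := by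
  intro n
  induction n with
  | zero => simp
  | succ n ih => rw [Fin.foldr_succ, Function.iterate_succ_apply', ← ih]

/-- **Pure word**: `D^n f(x)(v, …, v) = (D_v^[n] f)(x)` for `f ∈ Cⁿ(U)`, `U` open, `x ∈ U` — the idiom `(fun g => fun y => fderiv ℝ g y v)^[n] f` of ★
`iteratedDirDeriv_eq_iteratedDeriv_lineRestrict` (p850902 §3), which turns it into `iteratedDeriv n` of the restriction to the line `x + ℝ v`. [cite: Coleman2012, §4.5] -/
theorem iteratedFDeriv_apply_const_eq_iterate_fderiv {U : Set V} (hU : IsOpen U) {n : ℕ} {f : V → F} (hf : ContDiffOn ℝ n f U)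
    {x : V} (hx : x ∈ U) (v : V) :
    iteratedFDeriv ℝ n f x (fun _ => v) = ((fun g : V → F => fun y => fderiv ℝ g y v)^[n] f) x := by
  rw [iteratedFDeriv_apply_eq_foldr_fderiv hU n hf hx, foldr_const_eq_iterate]

/-- **Two blocks**: `D^{a+k} f(x)(v ++ w) = (D_{v 0} ⋯ D_{v (a-1)} (D_{w 0} ⋯ D_{w (k-1)} f))(x)` (`Fin.append`; the `w`-derivatives are taken first). [cite: Coleman2012, §4.5] -/
theorem iteratedFDeriv_apply_append_eq_foldr_foldr {U : Set V} (hU : IsOpen U) {a k : ℕ} {f : V → F} (hf : ContDiffOn ℝ (a + k) f U)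
    {x : V} (hx : x ∈ U) (v : Fin a → V) (w : Fin k → V) :
    iteratedFDeriv ℝ (a + k) f x (Fin.append v w) =
      Fin.foldr a (fun i (g : V → F) => fun y => fderiv ℝ g y (v i)) (Fin.foldr k (fun j (g : V → F) => fun y => fderiv ℝ g y (w j)) f) x := by
  have hf' : ContDiffOn ℝ ((a + k : ℕ) : WithTop ℕ∞) f U := by exact_mod_cast hf
  rw [iteratedFDeriv_apply_eq_foldr_fderiv hU (a + k) hf' hx, Fin.foldr_add]
  simp only [Fin.append_left', Fin.append_right]

/-- **The `∂_ψ^a ∂_y^β` shape**: `D^{a+k} f(x)(v, …, v, w 0, …, w (k-1)) = (D_v^[a] (D_{w 0} ⋯ D_{w (k-1)} f))(x)`. [cite: Coleman2012, §4.5] -/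
theorem iteratedFDeriv_apply_append_const_eq_iterate_foldr {U : Set V} (hU : IsOpen U) {a k : ℕ} {f : V → F} (hf : ContDiffOn ℝ (a + k) f U)
    {x : V} (hx : x ∈ U) (v : V) (w : Fin k → V) :
    iteratedFDeriv ℝ (a + k) f x (Fin.append (fun _ : Fin a => v) w) =
      ((fun g : V → F => fun y => fderiv ℝ g y v)^[a] (Fin.foldr k (fun j (g : V → F) => fun y => fderiv ℝ g y (w j)) f)) x := by
  rw [iteratedFDeriv_apply_append_eq_foldr_foldr hU hf hx, foldr_const_eq_iterate]

end Words

/-! ## §2 Graded bounds: nested partials along basis words bounded ⇒ `‖iteratedFDeriv ℝ n f‖` bounded -/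

section Bounds

variable {ι : Type*} [Fintype ι] {V : Type*} [NormedAddCommGroup V] [NormedSpace ℝ V] {F : Type*} [NormedAddCommGroup F] [NormedSpace ℝ F]

/-- **Entries form** (no smoothness needed): if the jet entries on basis tuples `D^n f(x)(b∘I)` are bounded on `A` for every word `I : Fin n → ι`, then `‖D^n f(x)‖` is
bounded on `A` (★ `exists_norm_le_pow_mul_sum_norm_apply_basis`: `‖A‖ ≤ Cⁿ Σ_I ‖A(b∘I)‖`). [cite: HormanderALPDO1, §1.1 pp. 7–12] -/
theorem exists_forall_norm_iteratedFDeriv_le_of_apply_basis (b : Module.Basis ι ℝ V) {A : Set V} {f : V → F} {n : ℕ}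
    (hbd : ∀ I : Fin n → ι, ∃ B : ℝ, ∀ x ∈ A, ‖iteratedFDeriv ℝ n f x (fun k => b (I k))‖ ≤ B) :
    ∃ B : ℝ, ∀ x ∈ A, ‖iteratedFDeriv ℝ n f x‖ ≤ B := by
  classical
  obtain ⟨C, hC0, hC⟩ := exists_norm_le_pow_mul_sum_norm_apply_basis (F := F) b
  choose B hB using hbd
  refine ⟨C ^ n * ∑ I : Fin n → ι, B I, fun x hx => (hC n (iteratedFDeriv ℝ n f x)).trans ?_⟩
  exact mul_le_mul_of_nonneg_left (Finset.sum_le_sum fun I _ => hB I x hx) (pow_nonneg hC0 n)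

/-- **(B2b) NESTED PARTIALS BOUNDED ⇒ JET BOUNDED** (single function, order `n`): if `f ∈ Cⁿ(U)`, `U` open, `A ⊆ U`, and for every basis word `I : Fin n → ι` the nested
directional derivative `D_{b(I 0)} ⋯ D_{b(I (n-1))} f` is bounded on `A`, then `‖D^n f(x)‖` is bounded on `A` (§1 dictionary + the entries form).
[cite: HormanderALPDO1, §1.1 pp. 7–12] -/
theorem exists_forall_norm_iteratedFDeriv_le_of_foldr_fderiv_basis (b : Module.Basis ι ℝ V) {U : Set V} (hU : IsOpen U) {A : Set V}
    (hAU : A ⊆ U) {f : V → F} {n : ℕ} (hf : ContDiffOn ℝ n f U)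
    (hbd : ∀ I : Fin n → ι, ∃ B : ℝ, ∀ x ∈ A, ‖Fin.foldr n (fun k (g : V → F) => fun y => fderiv ℝ g y (b (I k))) f x‖ ≤ B) :
    ∃ B : ℝ, ∀ x ∈ A, ‖iteratedFDeriv ℝ n f x‖ ≤ B := by
  refine exists_forall_norm_iteratedFDeriv_le_of_apply_basis b fun I => ?_
  obtain ⟨B, hB⟩ := hbd I
  exact ⟨B, fun x hx => by rw [iteratedFDeriv_apply_eq_foldr_fderiv hU n hf (hAU hx)]; exact hB x hx⟩

/-- **SORTED words suffice** (Schwarz): with a linear order on the index type `ι`, bounds on the nested partials along MONOTONE words `I : Fin n → ι` already bound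
`‖D^n f(x)‖` on `A` (`D^n f(x)` is symmetric at points of the open `U` — ★ `iteratedFDeriv_comp_perm_of_le` — and every word is a permutation of a sorted one, Mathlib
`Tuple.sort`).  For a product neighbourhood `(ψ, y)` with `ψ` indexed FIRST, the sorted words are exactly «`∂_ψ^a` outermost ∘ tangential word».
[cite: HormanderALPDO1, §1.1 pp. 7–12] -/
theorem exists_forall_norm_iteratedFDeriv_le_of_foldr_fderiv_basis_monotone [LinearOrder ι] (b : Module.Basis ι ℝ V) {U : Set V}
    (hU : IsOpen U) {A : Set V} (hAU : A ⊆ U) {f : V → F} {n : ℕ} (hf : ContDiffOn ℝ n f U)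
    (hbd : ∀ I : Fin n → ι, Monotone I → ∃ B : ℝ, ∀ x ∈ A, ‖Fin.foldr n (fun k (g : V → F) => fun y => fderiv ℝ g y (b (I k))) f x‖ ≤ B) :
    ∃ B : ℝ, ∀ x ∈ A, ‖iteratedFDeriv ℝ n f x‖ ≤ B := by
  refine exists_forall_norm_iteratedFDeriv_le_of_apply_basis b fun I => ?_
  obtain ⟨B, hB⟩ := hbd (I ∘ Tuple.sort I) (Tuple.monotone_sort I)
  refine ⟨B, fun x hx => ?_⟩
  have hfx : ContDiffAt ℝ n f x := hf.contDiffAt (hU.mem_nhds (hAU hx))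
  have hperm := iteratedFDeriv_comp_perm_of_le hfx le_rfl (fun k => b (I k)) (Tuple.sort I)
  rw [← hperm, show ((fun k => b (I k)) ∘ (Tuple.sort I)) = fun k => b ((I ∘ Tuple.sort I) k) from rfl,
    iteratedFDeriv_apply_eq_foldr_fderiv hU n hf (hAU hx)]
  exact hB x hx

/-- **All orders `k ≤ n` at once, `BddAbove` image form**: `f ∈ Cⁿ(U)`, `U` open, `A ⊆ U`, nested partials of every order `k ≤ n` along basis words bounded on `A` ⇒
`BddAbove ((‖iteratedFDeriv ℝ k f ·‖) '' A)` for every `k ≤ n`. [cite: HormanderALPDO1, §1.1 pp. 7–12] -/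
theorem bddAbove_norm_iteratedFDeriv_image_of_foldr_fderiv_basis (b : Module.Basis ι ℝ V) {U : Set V} (hU : IsOpen U) {A : Set V}
    (hAU : A ⊆ U) {f : V → F} {n : ℕ} (hf : ContDiffOn ℝ n f U)
    (hbd : ∀ k ≤ n, ∀ I : Fin k → ι, ∃ B : ℝ, ∀ x ∈ A, ‖Fin.foldr k (fun j (g : V → F) => fun y => fderiv ℝ g y (b (I j))) f x‖ ≤ B) :
    ∀ k ≤ n, BddAbove ((fun x => ‖iteratedFDeriv ℝ k f x‖) '' A) := by
  intro k hk
  have hfk : ContDiffOn ℝ k f U := hf.of_le (by exact_mod_cast hk)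
  obtain ⟨B, hB⟩ := exists_forall_norm_iteratedFDeriv_le_of_foldr_fderiv_basis b hU hAU hfk (hbd k hk)
  exact ⟨B, forall_mem_image.2 hB⟩

/-- Monotone-words variant of the `BddAbove` form. [cite: HormanderALPDO1, §1.1 pp. 7–12] -/
theorem bddAbove_norm_iteratedFDeriv_image_of_foldr_fderiv_basis_monotone [LinearOrder ι] (b : Module.Basis ι ℝ V) {U : Set V} (hU : IsOpen U)
    {A : Set V} (hAU : A ⊆ U) {f : V → F} {n : ℕ} (hf : ContDiffOn ℝ n f U)
    (hbd : ∀ k ≤ n, ∀ I : Fin k → ι, Monotone I →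
      ∃ B : ℝ, ∀ x ∈ A, ‖Fin.foldr k (fun j (g : V → F) => fun y => fderiv ℝ g y (b (I j))) f x‖ ≤ B) :
    ∀ k ≤ n, BddAbove ((fun x => ‖iteratedFDeriv ℝ k f x‖) '' A) := by
  intro k hk
  have hfk : ContDiffOn ℝ k f U := hf.of_le (by exact_mod_cast hk)
  obtain ⟨B, hB⟩ := exists_forall_norm_iteratedFDeriv_le_of_foldr_fderiv_basis_monotone b hU hAU hfk (hbd k hk)
  exact ⟨B, forall_mem_image.2 hB⟩

end Bounds

end Literature.Analysis.Calculus

end
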